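import Mathlib
import Literature.Analysis.FluidPDE.Tao2016AveragedNS.ShiftSetCascadeFlows
import Literature.Analysis.FluidPDE.Tao2016AveragedNS.ShiftSetCascadeFlux
import Summits.NavierStokesRegularity.NavierStokesRegularity.Theorems.TaoLadderRungTwoFlatCertificateGlueCheckerRowRemOn
import Summits.NavierStokesRegularity.NavierStokesRegularity.Theorems.TaoLadderRungTwoFlatCertificateGlueCheckerCoefTabOn
import HarnessLib

/-!
# Certificate glue on a shift set `𝕊`, XXVII-e / XXVIII-e: THE STEP AND CHAIN CHECKERS OVER A GENERIC COEFFICIENT-BOX TABLE — glue XXVII-d / XXVIII-d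
  (`stepCert_of_checksVR`, `stepCert_of_recVR`) with the on-the-fly coefficient boxes `coefBoxOf prec αq ωq Sp Sm` replaced by ANY table `cB` satisfying
  `CoefBoxOK` (in practice the checked lookup table of glue XXV-m) (helper for items stmt-NavierStokesRegularity-22987 `FlatGapCertificatesV2` (crux K_A♭ of
  route TaoLadderRungTwoFlat) and stmt-24295 K_A₂(64); cell harvest/h2-tao-ladder, p1 g16; PERFORMANCE: ×13 on the jets at n = 98, p = 16)

HONEST FRAMING: Tao-type MODEL lattices (Tao 2016 §4/§6 vocabulary, shift-set parametrised); soundness of a checker — NO certificate instance exists in the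
tree, nothing is certified here, no stub is closed, nothing here is a statement about the Navier–Stokes equations.
-/

-- the sub-problem namespace repeats the summit name by design (D-0017)
set_option linter.dupNamespace false

namespace Summit.NavierStokesRegularity.NavierStokesRegularity.Theorems

open Set Finset Literature.Analysis.FluidPDE Literature.Analysis.FluidPDE.TaoCascade
open Summit.NavierStokesRegularity.NavierStokesRegularity.Theorems.TaylorModelCert
open Summit.NavierStokesRegularity.NavierStokesRegularity.Theorems.TaylorModelReadout

namespace CertificateGlueOn

variable {m : ℕ} {Kb Ka : ℤ}

/-! ### XXVII-e: the step checker over a generic coefficient-box table -/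

/-- **THE VECTOR-LAYOUT STEP CHECKER OVER A GENERIC COEFFICIENT-BOX TABLE IS SOUND** (glue XXVII-d `stepCert_of_checksVR` with `coefBoxOf prec αq ωq Sp Sm`
replaced by any `cB` with `CoefBoxOK` — e.g. the tabulated `coefLookup` of glue XXV-m). [cite: Zgliczynski2002C1Lohner, §3–4 (Lohner-type parallelepiped frames and the C¹/variational enclosure); cell certificate format, Lohner step, vector remainder] -/
theorem stepCert_of_checksG (hKb : 0 ≤ Kb) (hKa : 1 ≤ Ka) {shifts : List (ℤ × ℤ × ℤ)} (hnd : shifts.Nodup)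
    (h𝕊 : IsNearestNeighbourSet shifts.toFinset) {q : ℚ} (hq : 0 < 1 + (q : ℝ))
    {αq : Fin m → Fin m → Fin m → ℤ × ℤ × ℤ → ℚ} {ωq : Fin m → ℤ → ℚ} (hω : ∀ i k, 0 < ωq i k)
    {prec p kexp nexp : ℕ} {Sp Sm : IntervalD} (hSp : sqrtCheck prec (1 + q) Sp = true)
    (hSm : sqrtCheck prec (1 / (1 + q)) Sm = true) {cB : Fin m → ℤ → Fin m → Fin m → ℤ × ℤ × ℤ → IntervalD}
    (hcoef : CoefBoxOK shifts (q : ℝ) (fun i₁ i₂ i μ => (αq i₁ i₂ i μ : ℝ)) Kb Ka (fun i k => (ωq i k : ℝ)) cB)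
    {M : ℤ → ℝ} {t : ℕ → ℝ} {Node Hull : ℕ → (Fin m → ℤ → ℝ) → Prop} {j : ℕ}
    {xD x'D rD r'D ρD ED E1D loD hiD : Array Dyad} {C Cn T : Array (Array Dyad)} {bD mC ρs δD : Dyad}
    {K A A' Eb Et h : ℚ}
    (hb : 0 ≤ bD.toReal) (hmC : 0 ≤ mC.toReal) (hρs : 0 ≤ ρs.toReal) (hAA' : A < A') (ht : t (j + 1) - t j = (h : ℝ))
    (hchkB : checkB m Kb Ka shifts (cB) bD = true)
    (h2 : checkAbsLe (m * winLen Kb Ka) xD mC = true)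
    (h3 : checkRowsLe (m * winLen Kb Ka) C rD ρD = true)
    (hhull : checkHull (m * winLen Kb Ka) ρD ED ρs = true)
    (h6 : checkRowsLe (m * winLen Kb Ka) T rD r'D = true)
    (h8 : checkERecVR m Kb Ka shifts (cB) p (dyadToRat bD) (dyadToRat mC) (dyadToRat ρs) h
      (dPArr (m * winLen Kb Ka) prec (IntervalD.polyLevelsA (m * winLen Kb Ka) prec
        (IntervalD.jetLevelsA (m * winLen Kb Ka) (pqBoxA Kb Ka prec shifts (cB)) prec
          (pointBoxA (m * winLen Kb Ka) xD) p) p (ofRatRel prec h)) x'D)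
      (kappaArr prec (m * winLen Kb Ka) Cn T
        (vcolsA Kb Ka prec shifts (cB) p
          (IntervalD.jetLevelsA (m * winLen Kb Ka) (pqBoxA Kb Ka prec shifts (cB)) prec
            (hullBoxA (m * winLen Kb Ka) xD ρD ED) p) (ofRatRel prec h) C) rD)
      (nveArr (m * winLen Kb Ka) (IntervalD.polyLevelsA (m * winLen Kb Ka) prec
        (IntervalD.varJetLevelsA (m * winLen Kb Ka) (pqBoxA Kb Ka prec shifts (cB)) prec
          (IntervalD.jetLevelsA (m * winLen Kb Ka) (pqBoxA Kb Ka prec shifts (cB)) prec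
            (hullBoxA (m * winLen Kb Ka) xD ρD ED) p) (symBoxA (m * winLen Kb Ka) ED) p) p (ofRatRel prec h)))
      E1D = true)
    (h9 : checkGuardV (dyadToRat bD) (dyadToRat mC) (dyadToRat ρs) h = true)
    (h13 : checkCoverV m Kb Ka shifts (cB) xD ρD ED loD hiD h A' = true)
    (h10 : checkLipT m Kb Ka shifts (cB) loD hiD K = true)
    (h11 : checkDefectT m Kb Ka prec shifts αq ωq Eb Et loD hiD Sp Sm δD = true)
    (h12 : checkGronwallK K (dyadToRat δD) h A kexp nexp = true)
    (hN : ∀ y, Node j y → PInParaV Kb Ka (fun i k => (ωq i k : ℝ)) (dvec (n := m * winLen Kb Ka) xD)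
      (dmat (n := m * winLen Kb Ka) C) (dvec (n := m * winLen Kb Ka) rD) (dvec (n := m * winLen Kb Ka) ED) y)
    (hH : ∀ u ∈ Icc 0 (h : ℝ), ∀ y q' : Fin m → ℤ → ℝ,
      ProdTube Kb Ka (fun i k => (ωq i k : ℝ)) (dvec (n := m * winLen Kb Ka) xD) (dvec (n := m * winLen Kb Ka) ρD)
        (dvec (n := m * winLen Kb Ka) ED) (vOf Kb Ka shifts (cB) loD hiD) u q' →
      (∀ i k, -Kb ≤ k → k ≤ Ka → |y i k - q' i k| ≤ (A : ℝ) * (ωq i k : ℝ)) → Hull j y)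
    (hN' : ∀ y, PInParaV Kb Ka (fun i k => (ωq i k : ℝ)) (dvec (n := m * winLen Kb Ka) x'D)
      (dmat (n := m * winLen Kb Ka) Cn) (dvec (n := m * winLen Kb Ka) r'D) (fun c => dvec (n := m * winLen Kb Ka) E1D c + (A : ℝ)) y →
      Node (j + 1) y) :
    StepCert shifts.toFinset (q : ℝ) (fun i₁ i₂ i μ => (αq i₁ i₂ i μ : ℝ)) Kb Ka (Eb : ℝ) (Et : ℝ) M t Node Hull j := by
  have hω' : ∀ i k, (0 : ℝ) < (ωq i k : ℝ) := fun i k => by exact_mod_cast hω i k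
  have hKK : 0 ≤ Ka + Kb + 1 := by omega
  have hX : (pointBoxA (m * winLen Kb Ka) xD).size = m * winLen Kb Ka := by simp [pointBoxA]
  have hx := mem_pointBoxA (m * winLen Kb Ka) xD
  have hhmem : IntervalD.mem (t (j + 1) - t j) (ofRatRel prec h) := by rw [ht]; exact mem_ofRatRel prec h
  have hg := guardV_of_check h9
  have hgr := gronwallK_of_check h12
  have hKδ := nonneg_of_checkGronwallK h12
  have hE := eRecVR_of_check h8 hKK
  simp only [cast_dyadToRat] at hg hgr hKδ hE
  have hAA'r : (A : ℝ) < (A' : ℝ) := by exact_mod_cast hAA'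
  have hA0 : (0 : ℝ) ≤ (A : ℝ) := (gronwallBound_nonneg_of_zero hKδ.2 hg.1).trans hgr
  have hA' : 0 < A' := by
    have : (0 : ℝ) < (A' : ℝ) := hA0.trans_lt hAA'r
    exact_mod_cast this
  refine stepCert_of_plohner_mvr (ω := fun i k => (ωq i k : ℝ)) (p := p) hKb hKa hq hω' hb hmC hρs hKδ.1 hKδ.2 hAA'r
    (by rw [ht]; exact hg.1) (by rw [ht]; exact hg.2) (hB_of_checkB hKb hKa hω' hq hnd hcoef hchkB)
    (hBrow2_of_coefBox hKb hKa hω' hq hnd hcoef)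
    (abs_le_of_checkAbsLe h2) (mulVec_le_of_checkRowsLe h3) (hull_le_of_checkHull hhull)
    (abs_TPoly_sub_le_dPArr hKb hKa hnd hcoef p hX hx hhmem x'D)
    (kappa_of_kappaArr hKb hKa hnd hcoef p xD ρD ED hhmem C Cn T rD)
    (abs_VPoly_le_nveArr hKb hKa hnd hcoef p xD ρD ED hhmem)
    (mulVec_le_of_checkRowsLe h6) (fun c => by rw [ht]; exact hE c)
    (pqcN_prod_bound hKb hKa hω' hq hnd hcoef loD hiD)
    (fun c => vRowSum_nonneg hnd loD hiD _ _)
    (fun c => by rw [ht]; exact hG_of_checkCoverV hnd hA' h13 hKK c)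
    (fun u hu q' y hq' hnear => inBox_of_checkCoverV hnd hω h13 (by rwa [ht] at hu) hq' hnear)
    (pfieldLip_of_checkLipT hKb hKa hω' hq hcoef h10)
    (pinputDefect_of_checkDefectT prec hnd h𝕊 hq hω hSp hSm h11) (by rw [ht]; exact hgr) hN
    (fun u hu y q' hq' hnear => hH u (by rwa [ht] at hu) y q' hq' hnear) hN'

/-! ### XXVIII-e: the hull family and the chain step over a generic coefficient-box table -/

/-- The hull family DEFINED as the time-resolved product tube of step `j` with the table `V` of the coefficient boxes `cB` on its own box, fattened by `A j`.
[folklore] -/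
def hullOfG (Kb Ka : ℤ) (shifts : List (ℤ × ℤ × ℤ)) (cB : Fin m → ℤ → Fin m → Fin m → ℤ × ℤ × ℤ → IntervalD) (ωq : Fin m → ℤ → ℚ)
    (rec : ℕ → VRec) (j : ℕ) (y : Fin m → ℤ → ℝ) : Prop :=
  ∃ u ∈ Icc (0 : ℝ) ((rec j).h : ℝ), ∃ q' : Fin m → ℤ → ℝ,
    ProdTube Kb Ka (fun i k => (ωq i k : ℝ)) (dvec (n := m * winLen Kb Ka) (rec j).x) (dvec (n := m * winLen Kb Ka) (rec j).ρ)
      (dvec (n := m * winLen Kb Ka) (rec j).E) (vOf Kb Ka shifts cB (rec j).lo (rec j).hi) u q' ∧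
    ∀ i k, -Kb ≤ k → k ≤ Ka → |y i k - q' i k| ≤ ((rec j).A : ℝ) * (ωq i k : ℝ)

/-- Every hull state lies in the weighted box `[lo, hi]·ω` of its step, by the cover test (C13v). [folklore] -/
theorem inBox_of_hullOfG {shifts : List (ℤ × ℤ × ℤ)} (hnd : shifts.Nodup) {cB : Fin m → ℤ → Fin m → Fin m → ℤ × ℤ × ℤ → IntervalD}
    {ωq : Fin m → ℤ → ℚ} (hω : ∀ i k, 0 < ωq i k) {rec : ℕ → VRec} {j : ℕ} (hAA' : (rec j).A ≤ (rec j).A')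
    (h13 : checkCoverV m Kb Ka shifts cB (rec j).x (rec j).ρ (rec j).E (rec j).lo (rec j).hi (rec j).h (rec j).A' = true)
    {y : Fin m → ℤ → ℝ} (hy : hullOfG Kb Ka shifts cB ωq rec j y) :
    InBoxOn Kb Ka (wbox Kb Ka (fun i k => (ωq i k : ℝ)) (rec j).lo) (wbox Kb Ka (fun i k => (ωq i k : ℝ)) (rec j).hi) y := by
  obtain ⟨u, hu, q', htube, hnear⟩ := hy
  have hAA'r : ((rec j).A : ℝ) ≤ ((rec j).A' : ℝ) := by exact_mod_cast hAA'
  exact inBox_of_checkCoverV (Kb := Kb) (Ka := Ka) hnd hω h13 hu htube fun i k hk1 hk2 => (hnear i k hk1 hk2).trans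
    (mul_le_mul_of_nonneg_right hAA'r (by exact_mod_cast (hω i k).le))

/-- Box consequence, weighted form. [folklore] -/
theorem hull_coord_boundsG {shifts : List (ℤ × ℤ × ℤ)} (hnd : shifts.Nodup) {cB : Fin m → ℤ → Fin m → Fin m → ℤ × ℤ × ℤ → IntervalD}
    {ωq : Fin m → ℤ → ℚ} (hω : ∀ i k, 0 < ωq i k) {rec : ℕ → VRec} {j : ℕ} (hAA' : (rec j).A ≤ (rec j).A')
    (h13 : checkCoverV m Kb Ka shifts cB (rec j).x (rec j).ρ (rec j).E (rec j).lo (rec j).hi (rec j).h (rec j).A' = true)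
    {y : Fin m → ℤ → ℝ} (hy : hullOfG Kb Ka shifts cB ωq rec j y) (i : Fin m) {k : ℤ} (hk : -Kb ≤ k ∧ k ≤ Ka) :
    (ωq i k : ℝ) * (dgetD (rec j).lo (idxOf Kb Ka i k hk)).toReal ≤ y i k ∧
      y i k ≤ (ωq i k : ℝ) * (dgetD (rec j).hi (idxOf Kb Ka i k hk)).toReal := by
  have h := inBox_of_hullOfG hnd hω hAA' h13 hy i k hk.1 hk.2
  simp only [wbox, dif_pos hk] at h
  exact h



/-- **`StepCert j` OF THE DEFINITIONAL MESH (VECTOR LAYOUT, GENERIC COEFFICIENT TABLE) FROM THE TESTS OF RECORD `j` AND THE HAND-OVER TO RECORD `j+1`.**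
[cite: Zgliczynski2002C1Lohner, §3–4 (Lohner-type parallelepiped frames and the C¹/variational enclosure); cell certificate format, chain checker, vector remainder] -/
theorem stepCert_of_recG (hKb : 0 ≤ Kb) (hKa : 1 ≤ Ka) {shifts : List (ℤ × ℤ × ℤ)} (hnd : shifts.Nodup)
    (h𝕊 : IsNearestNeighbourSet shifts.toFinset) {q : ℚ} (hq : 0 < 1 + (q : ℝ))
    {αq : Fin m → Fin m → Fin m → ℤ × ℤ × ℤ → ℚ} {ωq : Fin m → ℤ → ℚ} (hω : ∀ i k, 0 < ωq i k)
    {prec p kexp nexp : ℕ} {Sp Sm : IntervalD} (hSp : sqrtCheck prec (1 + q) Sp = true)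
    (hSm : sqrtCheck prec (1 / (1 + q)) Sm = true) {cB : Fin m → ℤ → Fin m → Fin m → ℤ × ℤ × ℤ → IntervalD}
    (hcoef : CoefBoxOK shifts (q : ℝ) (fun i₁ i₂ i μ => (αq i₁ i₂ i μ : ℝ)) Kb Ka (fun i k => (ωq i k : ℝ)) cB)
    {M : ℤ → ℝ} {t : ℕ → ℝ} {rec : ℕ → VRec} {j : ℕ}
    {bD : Dyad} {Eb Et : ℚ}
    (hb : 0 ≤ bD.toReal) (hmC : 0 ≤ (rec j).mC.toReal) (hρs : 0 ≤ (rec j).ρs.toReal)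
    (hAA' : (rec j).A < (rec j).A') (ht : t (j + 1) - t j = ((rec j).h : ℝ))
    (hnext : checkHandsOverV (m * winLen Kb Ka) (rec j) (rec (j + 1)) = true)
    (hchkB : checkB m Kb Ka shifts (cB) bD = true)
    (h2 : checkAbsLe (m * winLen Kb Ka) (rec j).x (rec j).mC = true)
    (h3 : checkRowsLe (m * winLen Kb Ka) (rec j).C (rec j).r (rec j).ρ = true)
    (hhull : checkHull (m * winLen Kb Ka) (rec j).ρ (rec j).E (rec j).ρs = true)
    (h6 : checkRowsLe (m * winLen Kb Ka) (rec j).T (rec j).r (rec j).r' = true)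
    (h8 : checkERecVR m Kb Ka shifts (cB) p (dyadToRat bD) (dyadToRat (rec j).mC) (dyadToRat (rec j).ρs) (rec j).h
      (dPArr (m * winLen Kb Ka) prec (IntervalD.polyLevelsA (m * winLen Kb Ka) prec
        (IntervalD.jetLevelsA (m * winLen Kb Ka) (pqBoxA Kb Ka prec shifts (cB)) prec
          (pointBoxA (m * winLen Kb Ka) (rec j).x) p) p (ofRatRel prec (rec j).h)) (rec j).x')
      (kappaArr prec (m * winLen Kb Ka) (rec j).Cn (rec j).T
        (vcolsA Kb Ka prec shifts (cB) p
          (IntervalD.jetLevelsA (m * winLen Kb Ka) (pqBoxA Kb Ka prec shifts (cB)) prec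
            (hullBoxA (m * winLen Kb Ka) (rec j).x (rec j).ρ (rec j).E) p) (ofRatRel prec (rec j).h) (rec j).C) (rec j).r)
      (nveArr (m * winLen Kb Ka) (IntervalD.polyLevelsA (m * winLen Kb Ka) prec
        (IntervalD.varJetLevelsA (m * winLen Kb Ka) (pqBoxA Kb Ka prec shifts (cB)) prec
          (IntervalD.jetLevelsA (m * winLen Kb Ka) (pqBoxA Kb Ka prec shifts (cB)) prec
            (hullBoxA (m * winLen Kb Ka) (rec j).x (rec j).ρ (rec j).E) p) (symBoxA (m * winLen Kb Ka) (rec j).E) p) p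
          (ofRatRel prec (rec j).h)))
      (rec j).E1 = true)
    (h9 : checkGuardV (dyadToRat bD) (dyadToRat (rec j).mC) (dyadToRat (rec j).ρs) (rec j).h = true)
    (h13 : checkCoverV m Kb Ka shifts (cB) (rec j).x (rec j).ρ (rec j).E (rec j).lo (rec j).hi (rec j).h
      (rec j).A' = true)
    (h10 : checkLipT m Kb Ka shifts (cB) (rec j).lo (rec j).hi (rec j).K = true)
    (h11 : checkDefectT m Kb Ka prec shifts αq ωq Eb Et (rec j).lo (rec j).hi Sp Sm (rec j).δ = true)
    (h12 : checkGronwallK (rec j).K (dyadToRat (rec j).δ) (rec j).h (rec j).A kexp nexp = true) :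
    StepCert shifts.toFinset (q : ℝ) (fun i₁ i₂ i μ => (αq i₁ i₂ i μ : ℝ)) Kb Ka (Eb : ℝ) (Et : ℝ) M t
      (nodeOfV Kb Ka ωq rec) (hullOfG Kb Ka shifts cB ωq rec) j := by
  refine stepCert_of_checksG hKb hKa hnd h𝕊 hq hω hSp hSm hcoef hb hmC hρs hAA' ht hchkB h2 h3 hhull h6 h8 h9 h13 h10 h11 h12 (fun _ hy => hy)
    (fun u hu _ q' hq' hnear => ?_) (fun _ hy => node_of_checkHandsOverV hnext hy)
  exact ⟨u, hu, q', hq', hnear⟩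

end CertificateGlueOn

end Summit.NavierStokesRegularity.NavierStokesRegularity.Theorems
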